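import Literature.Analysis.FluidPDE.NSRegFourierMild
import HarnessLib

/-!
# Global Fourier-side mild solutions of the Leray-regularised Navier–Stokes system

Fifth file of the Fourier-side construction of the global regular solution of the
Leray-regularised Navier–Stokes system (discharge of
`Literature.Analysis.FluidPDE.leray_regularised_wellposed`). With the notion `IsRegMild` of
`NSRegFourierMild` (regularised mild solution on `[t₀, t₁]` with weight `K`), this file carries out
the classical continuation argument (Leray 1934, §21/§26: the local construction is restarted from
`u(t₁)`, the existence time being bounded below in terms of `W(t) = ‖u(t)‖₂` alone, which does not
increase; Ożański–Pooley 2018, Thm. 6.33; in the mild setting Lemarié-Rieusset 2016, Thm. 7.2):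

* `IsRegMild.mono`, `.translate`, `.clampRight`, `.of_le`, `.glue` — restriction, time translation,
  freezing after a time, lowering the weight, and gluing two solutions that agree at the junction;
* `IsRegMild.eLpNorm_le_card_mul` — the a priori bound `‖V(t)‖_{L²} ≤ card ι · ‖V(t₀)‖_{L²}` on
  `[t₀, t₁]` from the energy inequality (`IsRegMild.energy_le`);
* `IsRegMild.unique` — **uniqueness**: two regularised mild solutions on `[t₀, t₁]` with the same
  value at `t₀` coincide on `[t₀, t₁]` at every frequency (short-time `L²` contraction of the
  difference of the Duhamel terms, then induction over subintervals of fixed length);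
* `exists_global_regMild` — **global existence**: for `c > 0`, a mollifier symbol `m`, a weight
  `K` with `2K > card ι`, and a measurable, square-integrable, `wfun K`-square-integrable,
  transversal and conjugation-symmetric datum `a`, there is `V : ℝ → E → (ι → ℂ)` with `V 0 = a`
  such that `t ↦ V (min t T)` is a regularised mild solution on `[0, T]` for every `T > 0`
  (restarts of the `L²` Picard scheme of `NSRegFourierPicard` at the uniform step
  `rpicardTime c m K (card ι · ‖a‖_{L²})`);
* `exists_global_regMild_all` — if the datum is `wfun K`-square-integrable for **every** `K`, the
  same `V` is a regularised mild solution of every weight (uniqueness).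

## References

* J. Leray, Acta Math. 63 (1934), §§19–21, Ch. V §26. [Leray1934]
* W. S. Ożański, B. C. Pooley, LMS Lecture Note Ser. 452 (2018), Thm. 6.33, Cor. 6.25. [OzanskiPooley2018]
* P. G. Lemarié-Rieusset, *The Navier–Stokes problem in the 21st century* (2016), §7.3, Thm. 7.2.
-/

noncomputable section

open MeasureTheory Real Set Filter Topology Function Complex intervalIntegral
open scoped ENNReal NNReal ComplexConjugate

namespace Literature.Analysis.FluidPDE.FourierNS

variable {ι : Type*} [Fintype ι] [DecidableEq ι]

namespace IsRegMild

variable {c t₀ t₁ : ℝ} {m : (EuclideanSpace ℝ ι) → ℝ} {K : ℕ} {V W : ℝ → (EuclideanSpace ℝ ι) → ι → ℂ}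

/-! ### Restriction, translation, freezing, lowering the weight -/

/-- Restriction to a sub-interval. [folklore] -/
theorem mono (h : IsRegMild c m K t₀ t₁ V) {s₀ s₁ : ℝ} (h₀ : t₀ ≤ s₀) (h₀₁ : s₀ ≤ s₁) (h₁ : s₁ ≤ t₁) :
    IsRegMild c m K s₀ s₁ V where
  hc := h.hc
  hm := h.hm
  le := h₀₁
  meas := h.meas
  cont := h.cont
  dom := h.dom
  boundK := h.boundK
  duhamel := fun _ _ hs hst ht ξ => h.duhamel (h₀.trans hs) hst (ht.trans h₁) ξ
  divFree := h.divFree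
  conjSymm := h.conjSymm

/-- Lowering the weight. [folklore] -/
theorem of_le (h : IsRegMild c m K t₀ t₁ V) {K' : ℕ} (hK' : K' ≤ K) : IsRegMild c m K' t₀ t₁ V where
  hc := h.hc
  hm := h.hm
  le := h.le
  meas := h.meas
  cont := h.cont
  dom := h.dom
  boundK := by
    obtain ⟨B, hB, hle⟩ := h.boundK
    exact ⟨B, hB, fun t => (eLpNorm_wfun_mono hK' (V t) 2).trans (hle t)⟩
  duhamel := h.duhamel
  divFree := h.divFree
  conjSymm := h.conjSymm

/-- **Time translation**: `t ↦ V(t - d)` is a regularised mild solution on `[t₀ + d, t₁ + d]`. [folklore] -/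
theorem translate (h : IsRegMild c m K t₀ t₁ V) (d : ℝ) :
    IsRegMild c m K (t₀ + d) (t₁ + d) (fun t => V (t - d)) where
  hc := h.hc
  hm := h.hm
  le := by linarith [h.le]
  meas := by
    have : uncurry (fun t => V (t - d)) = uncurry V ∘ fun p : ℝ × EuclideanSpace ℝ ι => (p.1 - d, p.2) := by
      funext p; rfl
    rw [this]; exact h.meas.comp (by fun_prop)
  cont := fun ξ => (h.cont ξ).comp (continuous_id.sub continuous_const)
  dom := by
    obtain ⟨G, hGm, hG2, hle⟩ := h.dom
    exact ⟨G, hGm, hG2, fun t ξ => hle (t - d) ξ⟩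
  boundK := by
    obtain ⟨B, hB, hle⟩ := h.boundK
    exact ⟨B, hB, fun t => hle (t - d)⟩
  duhamel := by
    intro s t hs hst ht ξ
    have hD := h.duhamel (s := s - d) (t := t - d) (by linarith) (by linarith) (by linarith) ξ
    have hsub : t - d - (s - d) = t - s := by ring
    rw [hsub] at hD
    rw [hD]
    congr 1
    rw [← intervalIntegral.integral_comp_sub_right
      (fun r => heat c ξ (t - d - r) • nonlin (vmul m (V r)) (V r) ξ) d]
    refine intervalIntegral.integral_congr fun r _ => ?_
    show heat c ξ (t - d - (r - d)) • nonlin (vmul m (V (r - d))) (V (r - d)) ξ =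
      heat c ξ (t - r) • nonlin (vmul m (V (r - d))) (V (r - d)) ξ
    rw [show t - d - (r - d) = t - r by ring]
  divFree := fun t ξ => h.divFree (t - d) ξ
  conjSymm := fun t ξ l => h.conjSymm (t - d) ξ l

/-- **Freezing after a time**: `t ↦ V(min t T)` is a regularised mild solution on `[t₀, T]` for
`t₀ ≤ T ≤ t₁` (its values on `[t₀, T]` are those of `V`). [folklore] -/
theorem clampRight (h : IsRegMild c m K t₀ t₁ V) {T : ℝ} (h₀ : t₀ ≤ T) (h₁ : T ≤ t₁) :
    IsRegMild c m K t₀ T (fun t => V (min t T)) where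
  hc := h.hc
  hm := h.hm
  le := h₀
  meas := by
    have : uncurry (fun t => V (min t T)) = uncurry V ∘ fun p : ℝ × EuclideanSpace ℝ ι => (min p.1 T, p.2) := by
      funext p; rfl
    rw [this]; exact h.meas.comp ((measurable_fst.min measurable_const).prodMk measurable_snd)
  cont := fun ξ => (h.cont ξ).comp (continuous_id.min continuous_const)
  dom := by
    obtain ⟨G, hGm, hG2, hle⟩ := h.dom
    exact ⟨G, hGm, hG2, fun t ξ => hle (min t T) ξ⟩
  boundK := by
    obtain ⟨B, hB, hle⟩ := h.boundK
    exact ⟨B, hB, fun t => hle (min t T)⟩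
  duhamel := by
    intro s t hs hst ht ξ
    rw [min_eq_left ht, min_eq_left (hst.trans ht), h.duhamel hs hst (ht.trans h₁) ξ]
    congr 1
    refine intervalIntegral.integral_congr fun r hr => ?_
    rw [uIcc_of_le hst] at hr
    simp only [min_eq_left (hr.2.trans ht)]
  divFree := fun t ξ => h.divFree (min t T) ξ
  conjSymm := fun t ξ l => h.conjSymm (min t T) ξ l

/-! ### Gluing -/

/-- **Gluing two regularised mild solutions that agree at the junction.** If `V` is a
regularised mild solution on `[t₀, t']`, `W` one on `[t', t₁]` (same rate, multiplier and weight)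
and `V(t') = W(t')`, then `t ↦ if t ≤ t' then V t else W t` is a regularised mild solution on
`[t₀, t₁]` (the restarting step of the continuation argument: the Duhamel formulas combine by the
semigroup law of the heat factor and additivity of the time integral; Leray 1934, §21;
Lemarié-Rieusset 2016, Thm. 7.2). [folklore] -/
theorem glue {t' : ℝ} (hV : IsRegMild c m K t₀ t' V) (hW : IsRegMild c m K t' t₁ W) (hVW : V t' = W t') :
    IsRegMild c m K t₀ t₁ (fun t => if t ≤ t' then V t else W t) := by
  obtain ⟨G, hG⟩ : ∃ G : ℝ → (EuclideanSpace ℝ ι) → ι → ℂ, ∀ t, G t = if t ≤ t' then V t else W t := ⟨_, fun t => rfl⟩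
  have hGfun : (fun t => if t ≤ t' then V t else W t) = G := funext fun t => (hG t).symm
  rw [hGfun]
  have hGle : ∀ {t}, t ≤ t' → G t = V t := fun {t} ht => by rw [hG t, if_pos ht]
  have hGge : ∀ {t}, t' ≤ t → G t = W t := fun {t} ht => by
    rcases eq_or_lt_of_le ht with h | h
    · rw [← h, hGle le_rfl, hVW]
    · rw [hG t, if_neg (not_le.2 h)]
  have hm := hV.hm.measurable
  have hm1 := hV.hm.abs_le_one
  -- measurability
  have hmeas : Measurable (uncurry G) := by
    have : uncurry G = fun p : ℝ × EuclideanSpace ℝ ι => if p.1 ≤ t' then uncurry V p else uncurry W p := by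
      funext p; simp only [uncurry, hG p.1]; split_ifs <;> rfl
    rw [this]
    exact Measurable.ite (measurableSet_le measurable_fst measurable_const) hV.meas hW.meas
  -- continuity in time at each frequency
  have hcont : ∀ ξ, Continuous fun t => G t ξ := by
    intro ξ
    have : (fun t => G t ξ) = fun t => if t ≤ t' then V t ξ else W t ξ := by
      funext t; rw [hG t]; split_ifs <;> rfl
    rw [this]
    refine Continuous.if_le (hV.cont ξ) (hW.cont ξ) continuous_id continuous_const ?_
    rintro t rfl
    rw [hVW]
  -- domination and weighted bound
  have hdom : ∃ G' : (EuclideanSpace ℝ ι) → ℝ≥0∞, Measurable G' ∧ ∫⁻ ξ, G' ξ ^ 2 < ∞ ∧ ∀ t ξ, ‖G t ξ‖ₑ ≤ G' ξ := by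
    obtain ⟨G₁, hG₁m, hG₁2, hle₁⟩ := hV.dom
    obtain ⟨G₂, hG₂m, hG₂2, hle₂⟩ := hW.dom
    refine ⟨fun ξ => G₁ ξ + G₂ ξ, hG₁m.add hG₂m, ?_, fun t ξ => ?_⟩
    · calc ∫⁻ ξ, (G₁ ξ + G₂ ξ) ^ 2 ≤ ∫⁻ ξ, 4 * (G₁ ξ ^ 2 + G₂ ξ ^ 2) :=
            lintegral_mono fun ξ => RPicardHyp.sq_add_le_four_mul _ _
        _ = 4 * ((∫⁻ ξ, G₁ ξ ^ 2) + ∫⁻ ξ, G₂ ξ ^ 2) := by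
            rw [lintegral_const_mul' _ _ ENNReal.ofNat_ne_top, lintegral_add_left (hG₁m.pow_const 2)]
        _ < ∞ := ENNReal.mul_lt_top ENNReal.ofNat_lt_top (ENNReal.add_lt_top.2 ⟨hG₁2, hG₂2⟩)
    · by_cases ht : t ≤ t'
      · rw [hGle ht]; exact (hle₁ t ξ).trans le_self_add
      · rw [hGge (not_le.1 ht).le]; exact (hle₂ t ξ).trans le_add_self
  have hboundK : ∃ B : ℝ≥0∞, B ≠ ∞ ∧ ∀ t, eLpNorm (wfun K (G t)) 2 volume ≤ B := by
    obtain ⟨B₁, hB₁, hle₁⟩ := hV.boundK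
    obtain ⟨B₂, hB₂, hle₂⟩ := hW.boundK
    refine ⟨max B₁ B₂, by simp [hB₁, hB₂], fun t => ?_⟩
    by_cases ht : t ≤ t'
    · rw [hGle ht]; exact (hle₁ t).trans (le_max_left _ _)
    · rw [hGge (not_le.1 ht).le]; exact (hle₂ t).trans (le_max_right _ _)
  -- a slice bound for the glued field (for interval integrability of its Duhamel integrand)
  obtain ⟨G', hG'm, hG'2, hG'le⟩ := hdom
  obtain ⟨B, hBtop, hBle⟩ := hboundK
  have hA' : ∀ t, eLpNorm (G t) 2 volume ≤ (∫⁻ ξ, G' ξ ^ 2) ^ (1 / 2 : ℝ) := by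
    intro t
    rw [eLpNorm_eq_lintegral_rpow_enorm_toReal two_ne_zero ENNReal.ofNat_ne_top, ENNReal.toReal_ofNat]
    refine ENNReal.rpow_le_rpow (lintegral_mono fun ξ => ?_) (by norm_num)
    rw [ENNReal.rpow_two]
    exact pow_le_pow_left₀ zero_le (hG'le t ξ) 2
  have hSG : SliceBound K ((∫⁻ ξ, G' ξ ^ 2) ^ (1 / 2 : ℝ)) B G G :=
    ⟨hmeas, hmeas, hA', hBle, ENNReal.rpow_ne_top_of_nonneg (by norm_num) hG'2.ne, hBtop⟩
  refine
    { hc := hV.hc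
      hm := hV.hm
      le := hV.le.trans hW.le
      meas := hmeas
      cont := hcont
      dom := ⟨G', hG'm, hG'2, hG'le⟩
      boundK := ⟨B, hBtop, hBle⟩
      duhamel := ?_
      divFree := fun t ξ => ?_
      conjSymm := fun t ξ l => ?_ }
  · intro s t hs hst ht ξ
    have hintV : ∀ {τ a b : ℝ}, a ≤ b → b ≤ t' →
        ∫ r in a..b, heat c ξ (τ - r) • nonlin (vmul m (G r)) (G r) ξ =
          ∫ r in a..b, heat c ξ (τ - r) • nonlin (vmul m (V r)) (V r) ξ := by
      intro τ a b hab hb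
      refine intervalIntegral.integral_congr fun r hr => ?_
      rw [uIcc_of_le hab] at hr
      simp only [hGle (hr.2.trans hb)]
    have hintW : ∀ {τ a b : ℝ}, t' ≤ a → a ≤ b →
        ∫ r in a..b, heat c ξ (τ - r) • nonlin (vmul m (G r)) (G r) ξ =
          ∫ r in a..b, heat c ξ (τ - r) • nonlin (vmul m (W r)) (W r) ξ := by
      intro τ a b ha hab
      refine intervalIntegral.integral_congr fun r hr => ?_
      rw [uIcc_of_le hab] at hr
      simp only [hGge (ha.trans hr.1)]
    rcases le_total t t' with htt' | htt'
    · rw [hGle htt', hGle (hst.trans htt'), hintV hst htt']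
      exact hV.duhamel hs hst htt' ξ
    rcases le_total t' s with ht's | ht's
    · rw [hGge htt', hGge ht's, hintW ht's hst]
      exact hW.duhamel ht's hst ht ξ
    · have h1 := hW.duhamel le_rfl htt' ht ξ
      have h2 := hV.duhamel hs ht's le_rfl ξ
      rw [hGge htt', hGle ht's, h1, ← hVW, h2]
      have hIG : IntervalIntegrable (fun r => heat c ξ (t - r) • nonlin (vmul m (G r)) (G r) ξ) volume s t' ∧
          IntervalIntegrable (fun r => heat c ξ (t - r) • nonlin (vmul m (G r)) (G r) ξ) volume t' t :=
        ⟨hSG.intervalIntegrable_integrand' hm hm1 hV.hc.le t ξ s t',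
          hSG.intervalIntegrable_integrand' hm hm1 hV.hc.le t ξ t' t⟩
      rw [← intervalIntegral.integral_add_adjacent_intervals hIG.1 hIG.2, hintV ht's le_rfl,
        hintW le_rfl htt', smul_sub, ← intervalIntegral.integral_smul, smul_smul, ← heat_sub_sub]
      have hI : ∫ r in s..t', heat c ξ (t - t') • heat c ξ (t' - r) • nonlin (vmul m (V r)) (V r) ξ =
          ∫ r in s..t', heat c ξ (t - r) • nonlin (vmul m (V r)) (V r) ξ := by
        refine intervalIntegral.integral_congr fun r _ => ?_
        simp only [smul_smul, ← heat_sub_sub]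
      rw [hI]
      abel
  · by_cases ht : t ≤ t'
    · rw [hGle ht]; exact hV.divFree t ξ
    · rw [hGge (not_le.1 ht).le]; exact hW.divFree t ξ
  · by_cases ht : t ≤ t'
    · rw [hGle ht]; exact hV.conjSymm t ξ l
    · rw [hGge (not_le.1 ht).le]; exact hW.conjSymm t ξ l

end IsRegMild

/-! ### The a priori `L²` bound from the energy inequality -/

section APriori

variable {c t₀ t₁ : ℝ} {m : (EuclideanSpace ℝ ι) → ℝ} {K : ℕ} {V : ℝ → (EuclideanSpace ℝ ι) → ι → ℂ}

omit [DecidableEq ι] in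
/-- The sup norm on `ι → ℂ` against the Euclidean sum: `‖x‖ₑ² ≤ ∑ₗ ‖xₗ‖ₑ²`. Twin of
`FourierNS.enorm_sq_le_sum_enorm_sq` (`NSFourierSobolev`), restated in ten lines rather than importing the
`NSFourierRestart`/`NSEnstrophyPersistence` chain of that file. [folklore] -/
theorem enorm_sq_le_sum (x : ι → ℂ) : ‖x‖ₑ ^ 2 ≤ ∑ l, ‖x l‖ₑ ^ 2 := by
  have hreal : ‖x‖ ^ 2 ≤ ∑ l, ‖x l‖ ^ 2 := by
    have h1 : ‖x‖ ≤ Real.sqrt (∑ l, ‖x l‖ ^ 2) := by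
      refine (pi_norm_le_iff_of_nonneg (Real.sqrt_nonneg _)).2 fun l => ?_
      rw [← Real.sqrt_sq (norm_nonneg (x l))]
      exact Real.sqrt_le_sqrt (Finset.single_le_sum (f := fun l => ‖x l‖ ^ 2) (fun l _ => by positivity) (Finset.mem_univ l))
    calc ‖x‖ ^ 2 ≤ Real.sqrt (∑ l, ‖x l‖ ^ 2) ^ 2 := by gcongr
      _ = ∑ l, ‖x l‖ ^ 2 := Real.sq_sqrt (Finset.sum_nonneg fun l _ => by positivity)
  calc ‖x‖ₑ ^ 2 = ENNReal.ofReal (‖x‖ ^ 2) := by rw [← ofReal_norm, ENNReal.ofReal_pow (norm_nonneg _)]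
    _ ≤ ENNReal.ofReal (∑ l, ‖x l‖ ^ 2) := ENNReal.ofReal_le_ofReal hreal
    _ = ∑ l, ‖x l‖ₑ ^ 2 := by
        rw [ENNReal.ofReal_sum_of_nonneg fun l _ => by positivity]
        refine Finset.sum_congr rfl fun l _ => ?_
        rw [← ofReal_norm, ENNReal.ofReal_pow (norm_nonneg _)]

omit [DecidableEq ι] in
/-- The Euclidean sum against the sup norm: `∑ₗ ‖xₗ‖ₑ² ≤ card ι · ‖x‖ₑ²`. [folklore] -/
theorem sum_enorm_sq_le (x : ι → ℂ) : ∑ l, ‖x l‖ₑ ^ 2 ≤ (Fintype.card ι : ℝ≥0∞) * ‖x‖ₑ ^ 2 := by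
  calc ∑ l, ‖x l‖ₑ ^ 2 ≤ ∑ _l : ι, ‖x‖ₑ ^ 2 := Finset.sum_le_sum fun l _ => by
        gcongr; rw [← ofReal_norm, ← ofReal_norm]; exact ENNReal.ofReal_le_ofReal (norm_le_pi_norm x l)
    _ = (Fintype.card ι : ℝ≥0∞) * ‖x‖ₑ ^ 2 := by rw [Finset.sum_const, Finset.card_univ, nsmul_eq_mul]

omit [DecidableEq ι] in
/-- The Euclidean energy as a lower integral: `ofReal (∫ ∑ₗ ‖Wₗ‖²) = ∫⁻ ∑ₗ ‖Wₗ‖ₑ²` for `W ∈ L²`. [folklore] -/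
theorem ofReal_integral_sum_normSq {W : (EuclideanSpace ℝ ι) → ι → ℂ} (hW2 : MemLp W 2 volume) :
    ENNReal.ofReal (∫ ξ, ∑ l, ‖W ξ l‖ ^ 2) = ∫⁻ ξ, ∑ l, ‖W ξ l‖ₑ ^ 2 := by
  have hint : Integrable (fun ξ => ∑ l, ‖W ξ l‖ ^ 2) volume :=
    integrable_finsetSum _ fun l _ => IsRegMild.integrable_normSq_of_memLp (hW2.eval l)
  rw [ofReal_integral_eq_lintegral_ofReal hint (Eventually.of_forall fun ξ => Finset.sum_nonneg fun l _ => by positivity)]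
  refine lintegral_congr fun ξ => ?_
  rw [ENNReal.ofReal_sum_of_nonneg fun l _ => by positivity]
  refine Finset.sum_congr rfl fun l _ => ?_
  rw [← ofReal_norm, ENNReal.ofReal_pow (norm_nonneg _)]

omit [DecidableEq ι] in
/-- `‖W‖²_{L²} ≤ ofReal (∫ ∑ₗ ‖Wₗ‖²)`. [folklore] -/
theorem eLpNorm_sq_le_energy {W : (EuclideanSpace ℝ ι) → ι → ℂ} (hW2 : MemLp W 2 volume) :
    eLpNorm W 2 volume ^ 2 ≤ ENNReal.ofReal (∫ ξ, ∑ l, ‖W ξ l‖ ^ 2) := by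
  rw [ofReal_integral_sum_normSq hW2, ← lintegral_enorm_sq_eq_eLpNorm_sq]
  exact lintegral_mono fun ξ => enorm_sq_le_sum (W ξ)

omit [DecidableEq ι] in
/-- `ofReal (∫ ∑ₗ ‖Wₗ‖²) ≤ card ι · ‖W‖²_{L²}`. [folklore] -/
theorem energy_le_card_mul_eLpNorm_sq {W : (EuclideanSpace ℝ ι) → ι → ℂ} (hW : Measurable W) (hW2 : MemLp W 2 volume) :
    ENNReal.ofReal (∫ ξ, ∑ l, ‖W ξ l‖ ^ 2) ≤ (Fintype.card ι : ℝ≥0∞) * eLpNorm W 2 volume ^ 2 := by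
  rw [ofReal_integral_sum_normSq hW2, ← lintegral_enorm_sq_eq_eLpNorm_sq, ← lintegral_const_mul _ (hW.enorm.pow_const 2)]
  exact lintegral_mono fun ξ => sum_enorm_sq_le (W ξ)

/-- **The a priori `L²` bound**: a regularised mild solution with `1 ≤ K` satisfies
`‖V(t)‖_{L²} ≤ card ι · ‖V(t₀)‖_{L²}` for `t ∈ [t₀, t₁]` (the energy inequality between the
Euclidean energies, and the comparison of the sup norm of `ι → ℂ` with the Euclidean one; the
factor `card ι` is harmless). [folklore] -/
theorem IsRegMild.eLpNorm_le_card_mul (h : IsRegMild c m K t₀ t₁ V) (hK : 1 ≤ K) {t : ℝ} (ht : t ∈ Icc t₀ t₁) :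
    eLpNorm (V t) 2 volume ≤ (Fintype.card ι : ℝ≥0∞) * eLpNorm (V t₀) 2 volume := by
  have hsq : eLpNorm (V t) 2 volume ^ 2 ≤ ((Fintype.card ι : ℝ≥0∞) * eLpNorm (V t₀) 2 volume) ^ 2 := by
    calc eLpNorm (V t) 2 volume ^ 2 ≤ ENNReal.ofReal (∫ ξ, ∑ l, ‖V t ξ l‖ ^ 2) :=
          eLpNorm_sq_le_energy (h.memLp t)
      _ ≤ ENNReal.ofReal (∫ ξ, ∑ l, ‖V t₀ ξ l‖ ^ 2) := ENNReal.ofReal_le_ofReal (h.energy_le hK le_rfl ht.1 ht.2)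
      _ ≤ (Fintype.card ι : ℝ≥0∞) * eLpNorm (V t₀) 2 volume ^ 2 :=
          energy_le_card_mul_eLpNorm_sq (h.measurable_slice' t₀) (h.memLp t₀)
      _ ≤ (Fintype.card ι : ℝ≥0∞) ^ 2 * eLpNorm (V t₀) 2 volume ^ 2 := by
          refine mul_le_mul_left ?_ _
          rcases Nat.eq_zero_or_pos (Fintype.card ι) with h0 | hpos
          · simp [h0]
          · calc (Fintype.card ι : ℝ≥0∞) = (Fintype.card ι : ℝ≥0∞) ^ 1 := (pow_one _).symm
              _ ≤ (Fintype.card ι : ℝ≥0∞) ^ 2 := pow_le_pow_right₀ (by exact_mod_cast hpos) one_le_two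
      _ = ((Fintype.card ι : ℝ≥0∞) * eLpNorm (V t₀) 2 volume) ^ 2 := by rw [mul_pow]
  exact (ENNReal.pow_le_pow_left_iff two_ne_zero).1 hsq

end APriori

/-! ### Uniqueness -/

section Unique

variable {c T : ℝ} {m : (EuclideanSpace ℝ ι) → ℝ} {K₁ K₂ : ℕ} {V W : ℝ → (EuclideanSpace ℝ ι) → ι → ℂ} {A₁ A₂ : ℝ≥0∞}

/-- **Short-time uniqueness from time `0`.** Two regularised mild solutions on `[0, T]` with the
same value at `0` and global `L²` bounds `A₁`, `A₂` coincide on `[0, T]` at every frequency as soon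
as `2 C₀(c) T^{1/2} κ₀ (A₁ + A₂) ≤ 1`: the difference is `−(D(X, V) + D(W, X))`, `X` the difference
frozen to `[0, T]`, whose `L²` norm is at most half the supremum of `‖X‖_{L²}` — so that supremum
vanishes — and whose value at every frequency is then zero by the pointwise Duhamel bound
(Leray 1934, §18 "théorème d'unicité"; Lemarié-Rieusset 2016, Thm. 7.2). [folklore] -/
theorem IsRegMild.unique_short (h₁ : IsRegMild c m K₁ 0 T V) (h₂ : IsRegMild c m K₂ 0 T W) (h0 : V 0 = W 0)
    (hA₁ : ∀ t, eLpNorm (V t) 2 volume ≤ A₁) (hA₂ : ∀ t, eLpNorm (W t) 2 volume ≤ A₂) (hA₁t : A₁ ≠ ∞) (hA₂t : A₂ ≠ ∞)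
    (hsmall : 2 * (C₀ c * ENNReal.ofReal T ^ (1 / 2 : ℝ) * kap m 0 * (A₁ + A₂)) ≤ 1) :
    ∀ t ∈ Icc 0 T, V t = W t := by
  have hT : 0 ≤ T := h₁.le
  have hm := h₁.hm.measurable
  have hm1 := h₁.hm.abs_le_one
  have hc := h₁.hc
  -- the frozen difference and its sup
  set X : ℝ → (EuclideanSpace ℝ ι) → ι → ℂ := fun r => V (clamp T r) - W (clamp T r) with hX
  set δ : ℝ≥0∞ := ⨆ r, eLpNorm (X r) 2 volume with hδ
  have hXle : ∀ r, eLpNorm (X r) 2 volume ≤ δ := fun r => le_iSup (fun r => eLpNorm (X r) 2 volume) r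
  have hδfin : δ ≤ A₁ + A₂ := iSup_le fun r =>
    (eLpNorm_sub_le (h₁.measurable_slice' _).aestronglyMeasurable (h₂.measurable_slice' _).aestronglyMeasurable one_le_two).trans
      (add_le_add (hA₁ _) (hA₂ _))
  have hδtop : δ ≠ ∞ := ne_top_of_le_ne_top (ENNReal.add_ne_top.2 ⟨hA₁t, hA₂t⟩) hδfin
  have hXm : Measurable (uncurry X) := by
    have e : uncurry X = fun p : ℝ × EuclideanSpace ℝ ι => uncurry V (clamp T p.1, p.2) - uncurry W (clamp T p.1, p.2) := by
      funext p; rfl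
    rw [e]
    have hcl : Measurable fun p : ℝ × EuclideanSpace ℝ ι => (clamp T p.1, p.2) :=
      ((continuous_clamp T).measurable.comp measurable_fst).prodMk measurable_snd
    exact (h₁.meas.comp hcl).sub (h₂.meas.comp hcl)
  -- slice bounds of `(X, V)` and `(W, X)` at weight `0`
  have hS₁ : SliceBound 0 δ A₁ X V := ⟨hXm, h₁.meas, hXle, fun s => by simpa using hA₁ s, hδtop, hA₁t⟩
  have hS₂ : SliceBound 0 A₂ δ W X := ⟨h₂.meas, hXm, hA₂, fun s => by simpa using hXle s, hA₂t, hδtop⟩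
  -- the difference identity on `[0, T]`
  have hdiff : ∀ t ∈ Icc 0 T, ∀ ξ, V t ξ - W t ξ = -(duhamelR c m T X V t ξ + duhamelR c m T W X t ξ) := by
    intro t ht ξ
    have hV := h₁.duhamel le_rfl ht.1 ht.2 ξ
    have hW := h₂.duhamel le_rfl ht.1 ht.2 ξ
    rw [sub_zero] at hV hW
    have hIV := h₁.sliceBound.intervalIntegrable_integrand hm hm1 hc.le ht.1 ξ (c := c)
    have hIW := h₂.sliceBound.intervalIntegrable_integrand hm hm1 hc.le ht.1 ξ (c := c)
    have hI₁ := hS₁.intervalIntegrable_integrand hm hm1 hc.le ht.1 ξ (c := c)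
    have hI₂ := hS₂.intervalIntegrable_integrand hm hm1 hc.le ht.1 ξ (c := c)
    rw [hV, hW, h0, duhamelR, duhamelR, clamp_of_mem ht, ← intervalIntegral.integral_add hI₁ hI₂]
    have hsub : (heat c ξ t • W 0 ξ - ∫ r in (0 : ℝ)..t, heat c ξ (t - r) • nonlin (vmul m (V r)) (V r) ξ) -
        (heat c ξ t • W 0 ξ - ∫ r in (0 : ℝ)..t, heat c ξ (t - r) • nonlin (vmul m (W r)) (W r) ξ) =
        -((∫ r in (0 : ℝ)..t, heat c ξ (t - r) • nonlin (vmul m (V r)) (V r) ξ) -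
          ∫ r in (0 : ℝ)..t, heat c ξ (t - r) • nonlin (vmul m (W r)) (W r) ξ) := by abel
    rw [hsub, ← intervalIntegral.integral_sub hIV hIW]
    congr 1
    refine intervalIntegral.integral_congr fun r hr => ?_
    rw [uIcc_of_le ht.1] at hr
    have hrT : r ∈ Icc 0 T := ⟨hr.1, hr.2.trans ht.2⟩
    have hXr : X r = V r - W r := by simp only [hX, clamp_of_mem hrT]
    simp only [← smul_add, ← smul_sub]
    congr 1
    rw [nonlin_vmul_self_sub_self hm hm1 (h₁.memLp r) (h₂.memLp r), hXr]
  -- the `L²` contraction: `δ ≤ δ/2`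
  have hcontr : ∀ t ∈ Icc 0 T, eLpNorm (V t - W t) 2 volume ≤ 2⁻¹ * δ := by
    intro t ht
    have hfun : V t - W t = fun ξ => -(duhamelR c m T X V t ξ + duhamelR c m T W X t ξ) := funext (hdiff t ht)
    rw [hfun, show (fun ξ => -(duhamelR c m T X V t ξ + duhamelR c m T W X t ξ)) =
      -(duhamelR c m T X V t + duhamelR c m T W X t) from rfl, eLpNorm_neg]
    refine (eLpNorm_add_le ((hS₁.measurable_duhamelR_slice hm c T t).aestronglyMeasurable)
      ((hS₂.measurable_duhamelR_slice hm c T t).aestronglyMeasurable) one_le_two).trans ?_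
    have hD₁ := hS₁.eLpNorm_wfun_duhamelR_le hm hc hT t
    have hD₂ := hS₂.eLpNorm_wfun_duhamelR_le hm hc hT t
    simp only [wfun_zero] at hD₁ hD₂
    refine (add_le_add hD₁ hD₂).trans ?_
    have halg : ENNReal.ofReal (4 * π) * ENNReal.ofReal (1 / (2 * c)) ^ (1 / 2 : ℝ) * ENNReal.ofReal T ^ (1 / 2 : ℝ) *
          ((Fintype.card ι : ℝ≥0∞) ^ 2 * (eLpNorm (fun ξ => (m ξ : ℂ)) 2 volume * δ * A₁)) +
        ENNReal.ofReal (4 * π) * ENNReal.ofReal (1 / (2 * c)) ^ (1 / 2 : ℝ) * ENNReal.ofReal T ^ (1 / 2 : ℝ) *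
          ((Fintype.card ι : ℝ≥0∞) ^ 2 * (eLpNorm (fun ξ => (m ξ : ℂ)) 2 volume * A₂ * δ)) =
        (C₀ c * ENNReal.ofReal T ^ (1 / 2 : ℝ) * kap m 0 * (A₁ + A₂)) * δ := by
      rw [C₀, kap, wfun_zero]; ring
    rw [halg]
    calc C₀ c * ENNReal.ofReal T ^ (1 / 2 : ℝ) * kap m 0 * (A₁ + A₂) * δ ≤ 2⁻¹ * δ := by
          refine mul_le_mul_left ?_ _
          rw [ENNReal.le_inv_iff_mul_le, mul_comm]
          exact hsmall
      _ = 2⁻¹ * δ := rfl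
  have hδ0 : δ = 0 := by
    have hle : δ ≤ 2⁻¹ * δ := iSup_le fun r => by
      have := hcontr (clamp T r) (clamp_mem_Icc hT r)
      simpa only [hX] using this
    have h2 : δ + δ ≤ δ + 0 := by
      calc δ + δ = 2 * δ := (two_mul δ).symm
        _ ≤ 2 * (2⁻¹ * δ) := mul_le_mul_right hle 2
        _ = δ := by rw [← mul_assoc, ENNReal.mul_inv_cancel two_ne_zero ENNReal.ofNat_ne_top, one_mul]
        _ = δ + 0 := (add_zero δ).symm
    exact le_antisymm ((ENNReal.add_le_add_iff_left hδtop).1 h2) zero_le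
  -- pointwise conclusion
  intro t ht
  funext ξ
  have hone : ∀ ξ : EuclideanSpace ℝ ι, (1 + ‖ξ‖) ^ 0 * |m ξ| ≤ 1 := fun ξ => by simpa using hm1 ξ
  have hD₁ := hS₁.weight_mul_enorm_duhamelR_le hm hc hT hone t ξ
  have hD₂ := hS₂.weight_mul_enorm_duhamelR_le hm hc hT hone t ξ
  simp only [pow_zero, ENNReal.ofReal_one, one_mul, hδ0, mul_zero, zero_mul, nonpos_iff_eq_zero, enorm_eq_zero] at hD₁ hD₂
  have := hdiff t ht ξ
  rw [hD₁, hD₂, add_zero, neg_zero, sub_eq_zero] at this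
  exact this

end Unique

section UniqueLong

variable {c t₀ t₁ : ℝ} {m : (EuclideanSpace ℝ ι) → ℝ} {K₁ K₂ : ℕ} {V W : ℝ → (EuclideanSpace ℝ ι) → ι → ℂ}

omit [DecidableEq ι] in
/-- The smallness condition of `unique_short` holds on every interval of length at most
`rpicardTime c m 0 (A₁ + A₂)`. [folklore] -/
theorem small_of_le_rpicardTime {A : ℝ≥0∞} (hm : IsMollifierSymbol m) (hA : A ≠ ∞) {T : ℝ}
    (hT : T ≤ rpicardTime c m 0 A) : 2 * (C₀ c * ENNReal.ofReal T ^ (1 / 2 : ℝ) * kap m 0 * A) ≤ 1 := by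
  have h1 := two_mul_rho_rpicardTime_le (hm.C₀_kap_A_ne_top c 0 hA)
  refine le_trans ?_ h1
  rw [rho]
  gcongr
  · exact le_mul_of_one_le_left zero_le (by norm_num)

/-- **Uniqueness of regularised mild solutions** (Leray 1934, §18 "théorème d'unicité", §26;
Lemarié-Rieusset 2016, Thm. 7.2): two regularised mild solutions on `[t₀, t₁]` (same heat rate and
multiplier, any weights) with the same value at `t₀` coincide on `[t₀, t₁]` at every frequency —
short-time uniqueness iterated over subintervals of the fixed length `rpicardTime c m 0 (A₁ + A₂)`,
`A₁`, `A₂` the global `L²` bounds. [folklore] -/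
theorem IsRegMild.unique (h₁ : IsRegMild c m K₁ t₀ t₁ V) (h₂ : IsRegMild c m K₂ t₀ t₁ W) (h0 : V t₀ = W t₀) :
    ∀ t ∈ Icc t₀ t₁, V t = W t := by
  set A : ℝ≥0∞ := h₁.A + h₂.A with hAdef
  have hAtop : A ≠ ∞ := ENNReal.add_ne_top.2 ⟨h₁.A_ne_top, h₂.A_ne_top⟩
  set τ : ℝ := rpicardTime c m 0 A with hτdef
  have hτ : 0 < τ := rpicardTime_pos c m 0 A
  -- induction over pieces of length `τ`
  have key : ∀ n : ℕ, ∀ t ∈ Icc t₀ (min t₁ (t₀ + n * τ)), V t = W t := by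
    intro n
    induction n with
    | zero =>
      intro t ht
      simp only [Nat.cast_zero, zero_mul, add_zero, min_eq_right h₁.le] at ht
      rw [le_antisymm ht.2 ht.1, h0]
    | succ n ih =>
      intro t ht
      set s : ℝ := min t₁ (t₀ + n * τ) with hsdef
      set s' : ℝ := min t₁ (t₀ + (n + 1 : ℕ) * τ) with hs'def
      rcases le_total t s with hts | hts
      · exact ih t ⟨ht.1, hts⟩
      -- `t ∈ [s, s']`: restart at `s`
      have hs₀ : t₀ ≤ s := le_min h₁.le (by nlinarith [hτ.le, (Nat.cast_nonneg n : (0 : ℝ) ≤ n)])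
      have hss' : s ≤ s' := by
        simp only [hsdef, hs'def]; refine min_le_min le_rfl ?_; push_cast; nlinarith [hτ.le]
      have hs'₁ : s' ≤ t₁ := min_le_left _ _
      have hlen : s' - s ≤ τ := by
        simp only [hsdef, hs'def]
        rcases le_total t₁ (t₀ + n * τ) with h | h
        · rw [min_eq_left h, min_eq_left (h.trans (by push_cast; nlinarith [hτ.le]))]; linarith
        · rw [min_eq_right h]; push_cast
          have := min_le_right t₁ (t₀ + (n + 1) * τ); linarith
      have hVs : V s = W s := ih s ⟨hs₀, le_rfl⟩
      -- translate the restrictions to `[0, s' - s]`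
      have h₁' : IsRegMild c m K₁ 0 (s' - s) (fun r => V (r - -s)) := by
        have := (h₁.mono hs₀ hss' hs'₁).translate (-s)
        rwa [add_neg_cancel, ← sub_eq_add_neg] at this
      have h₂' : IsRegMild c m K₂ 0 (s' - s) (fun r => W (r - -s)) := by
        have := (h₂.mono hs₀ hss' hs'₁).translate (-s)
        rwa [add_neg_cancel, ← sub_eq_add_neg] at this
      have hsmall : 2 * (C₀ c * ENNReal.ofReal (s' - s) ^ (1 / 2 : ℝ) * kap m 0 * (h₁.A + h₂.A)) ≤ 1 :=
        small_of_le_rpicardTime h₁.hm hAtop hlen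
      have hu := IsRegMild.unique_short h₁' h₂' (by simp [hVs]) (fun t => h₁.eLpNorm_le_A _) (fun t => h₂.eLpNorm_le_A _)
        h₁.A_ne_top h₂.A_ne_top hsmall (t - s) ⟨sub_nonneg.2 hts, by linarith [ht.2]⟩
      simpa using hu
  intro t ht
  obtain ⟨n, hn⟩ : ∃ n : ℕ, t₁ - t₀ ≤ n * τ := by
    obtain ⟨n, hn⟩ := exists_nat_ge ((t₁ - t₀) / τ)
    exact ⟨n, by rwa [div_le_iff₀ hτ] at hn⟩
  exact key n t ⟨ht.1, le_min ht.2 (by linarith [ht.2])⟩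

end UniqueLong

/-! ### Global existence by uniform restarts -/

section Global

variable {c : ℝ} {m : (EuclideanSpace ℝ ι) → ℝ} {K : ℕ} {a : (EuclideanSpace ℝ ι) → ι → ℂ}

omit [DecidableEq ι] in
/-- **Hypotheses of the global construction**: `c > 0`, a mollifier symbol, a weight `K` with
`2K > card ι`, and a measurable datum with `a ∈ L²`, `wfun K a ∈ L²`, transversal and conjugation
symmetric. [folklore] -/
structure GlobalHyp (c : ℝ) (m : (EuclideanSpace ℝ ι) → ℝ) (K : ℕ) (a : (EuclideanSpace ℝ ι) → ι → ℂ) : Prop where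
  /-- positivity of the heat rate -/
  hc : 0 < c
  /-- the multiplier is a mollifier symbol -/
  hm : IsMollifierSymbol m
  /-- the weight dominates half the dimension -/
  hK : Fintype.card ι < 2 * K
  /-- measurability of the datum -/
  meas : Measurable a
  /-- the datum is square integrable -/
  memL2 : eLpNorm a 2 volume < ∞
  /-- the weighted datum is square integrable -/
  memL2K : eLpNorm (wfun K a) 2 volume < ∞
  /-- transversality of the datum -/
  divFree : ∀ ξ, ∑ l, (ξ l : ℂ) * a ξ l = 0
  /-- conjugation symmetry of the datum -/
  conjSymm : ∀ ξ l, a (-ξ) l = conj (a ξ l)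

omit [DecidableEq ι] in
/-- The uniform `L²` radius `A* = card ι · ‖a‖_{L²}` of all restarts (the a priori bound
`IsRegMild.eLpNorm_le_card_mul`). [folklore] -/
def gRadius (a : (EuclideanSpace ℝ ι) → ι → ℂ) : ℝ≥0∞ := (Fintype.card ι : ℝ≥0∞) * eLpNorm a 2 volume

omit [DecidableEq ι] in
/-- The uniform restart step `τ = rpicardTime c m K A*`. [folklore] -/
def gStep (c : ℝ) (m : (EuclideanSpace ℝ ι) → ℝ) (K : ℕ) (a : (EuclideanSpace ℝ ι) → ι → ℂ) : ℝ :=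
  rpicardTime c m K (gRadius a)

/-- The restart data: `a₀ = a`, `a_{n+1} = v_n(τ)`, `v_n` the Picard limit from `a_n` on `[0, τ]`. [folklore] -/
def gData (c : ℝ) (m : (EuclideanSpace ℝ ι) → ℝ) (K : ℕ) (a : (EuclideanSpace ℝ ι) → ι → ℂ) :
    ℕ → (EuclideanSpace ℝ ι) → ι → ℂ
  | 0 => a
  | n + 1 => rpicardLimit c m (gStep c m K a) (gData c m K a n) (gStep c m K a)

/-- The `n`-th piece: the Picard limit from `a_n` on `[0, τ]`. [folklore] -/
def gPiece (c : ℝ) (m : (EuclideanSpace ℝ ι) → ℝ) (K : ℕ) (a : (EuclideanSpace ℝ ι) → ι → ℂ) (n : ℕ) :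
    ℝ → (EuclideanSpace ℝ ι) → ι → ℂ :=
  rpicardLimit c m (gStep c m K a) (gData c m K a n)

/-- The glued solution on `[0, (n+1)τ]`: `G₀ = v₀`, `G_{n+1} = G_n` up to time `(n+1)τ` and the
translated piece `v_{n+1}(· − (n+1)τ)` afterwards. [folklore] -/
def gGlue (c : ℝ) (m : (EuclideanSpace ℝ ι) → ℝ) (K : ℕ) (a : (EuclideanSpace ℝ ι) → ι → ℂ) :
    ℕ → ℝ → (EuclideanSpace ℝ ι) → ι → ℂ
  | 0 => gPiece c m K a 0
  | n + 1 => fun t => if t ≤ ((n : ℝ) + 1) * gStep c m K a then gGlue c m K a n t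
      else gPiece c m K a (n + 1) (t - ((n : ℝ) + 1) * gStep c m K a)

/-- **The global solution**: `V(t) = G_{⌈t/τ⌉}(t)`. [folklore] -/
def gSol (c : ℝ) (m : (EuclideanSpace ℝ ι) → ℝ) (K : ℕ) (a : (EuclideanSpace ℝ ι) → ι → ℂ) (t : ℝ) :
    (EuclideanSpace ℝ ι) → ι → ℂ :=
  gGlue c m K a ⌈t / gStep c m K a⌉₊ t

namespace GlobalHyp

omit [DecidableEq ι] in
/-- `A* < ∞`. [folklore] -/
theorem gRadius_ne_top (h : GlobalHyp c m K a) : gRadius a ≠ ∞ :=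
  ENNReal.mul_ne_top (ENNReal.natCast_ne_top _) h.memL2.ne

omit [DecidableEq ι] in
/-- `‖a‖_{L²} ≤ A*` (if `card ι = 0` both sides vanish). [folklore] -/
theorem eLpNorm_le_gRadius (_h : GlobalHyp c m K a) : eLpNorm a 2 volume ≤ gRadius a := by
  rw [gRadius]
  rcases Nat.eq_zero_or_pos (Fintype.card ι) with h0 | hpos
  · have : IsEmpty ι := Fintype.card_eq_zero_iff.1 h0
    have ha0 : a = 0 := by funext ξ; exact funext fun l => (this.false l).elim
    simp [ha0]
  · exact le_mul_of_one_le_left zero_le (by exact_mod_cast hpos)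

omit [DecidableEq ι] in
/-- `τ > 0`. [folklore] -/
theorem gStep_pos (_h : GlobalHyp c m K a) : 0 < gStep c m K a := rpicardTime_pos c m K _

omit [DecidableEq ι] in
/-- `1 ≤ K`. [folklore] -/
theorem one_le_K (h : GlobalHyp c m K a) : 1 ≤ K := by have := h.hK; omega

/-- **The induction**: for every `n`, the datum `a_n` is measurable, transversal, conjugation
symmetric, with `‖a_n‖_{L²} ≤ A*` and `wfun K a_n ∈ L²`; the glued field `G_n` is a regularised
mild solution on `[0, (n+1)τ]` with `G_n((n+1)τ) = a_{n+1}` and `G_n(0) = a`. [folklore] -/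
theorem step (h : GlobalHyp c m K a) (n : ℕ) :
    (Measurable (gData c m K a n) ∧ eLpNorm (gData c m K a n) 2 volume ≤ gRadius a ∧
      eLpNorm (wfun K (gData c m K a n)) 2 volume < ∞ ∧
      (∀ ξ, ∑ l, (ξ l : ℂ) * gData c m K a n ξ l = 0) ∧ (∀ ξ l, gData c m K a n (-ξ) l = conj (gData c m K a n ξ l))) ∧
    (IsRegMild c m K 0 (((n : ℝ) + 1) * gStep c m K a) (gGlue c m K a n) ∧
      gGlue c m K a n (((n : ℝ) + 1) * gStep c m K a) = gData c m K a (n + 1) ∧ gGlue c m K a n 0 = a) := by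
  set τ := gStep c m K a with hτdef
  have hτ : 0 < τ := h.gStep_pos
  -- the Picard hypotheses from the datum facts
  have hP : ∀ {b : (EuclideanSpace ℝ ι) → ι → ℂ}, Measurable b → eLpNorm b 2 volume ≤ gRadius a →
      eLpNorm (wfun K b) 2 volume < ∞ →
      RPicardHyp c m K τ (gRadius a) (eLpNorm (wfun K b) 2 volume) b := fun hb hbA hbK =>
    RPicardHyp.of_rpicardTime h.hc h.hm hb hbA le_rfl h.gRadius_ne_top hbK.ne
  induction n with
  | zero =>
    have hd : Measurable (gData c m K a 0) ∧ eLpNorm (gData c m K a 0) 2 volume ≤ gRadius a ∧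
        eLpNorm (wfun K (gData c m K a 0)) 2 volume < ∞ ∧
        (∀ ξ, ∑ l, (ξ l : ℂ) * gData c m K a 0 ξ l = 0) ∧ (∀ ξ l, gData c m K a 0 (-ξ) l = conj (gData c m K a 0 ξ l)) :=
      ⟨h.meas, h.eLpNorm_le_gRadius, h.memL2K, h.divFree, h.conjSymm⟩
    refine ⟨hd, ?_⟩
    have hPh := hP hd.1 hd.2.1 hd.2.2.1
    have hM : IsRegMild c m K 0 τ (gPiece c m K a 0) := hPh.isRegMild_limit h.hK hd.2.2.2.1 hd.2.2.2.2
    refine ⟨by simpa [gGlue] using hM, ?_, ?_⟩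
    · simp only [gGlue, gData, Nat.cast_zero, zero_add, one_mul]; rfl
    · simp only [gGlue, gPiece]
      funext ξ; exact hPh.limit_zero ξ
  | succ n ih =>
    obtain ⟨⟨hdm, hdA, hdK, hdd, hdc⟩, hG, hGend, hG0⟩ := ih
    have hPh := hP hdm hdA hdK
    -- the new datum `a_{n+1} = v_n(τ) = G_n((n+1)τ)`
    have hd' : Measurable (gData c m K a (n + 1)) ∧ eLpNorm (gData c m K a (n + 1)) 2 volume ≤ gRadius a ∧
        eLpNorm (wfun K (gData c m K a (n + 1))) 2 volume < ∞ ∧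
        (∀ ξ, ∑ l, (ξ l : ℂ) * gData c m K a (n + 1) ξ l = 0) ∧
        (∀ ξ l, gData c m K a (n + 1) (-ξ) l = conj (gData c m K a (n + 1) ξ l)) := by
      refine ⟨hPh.measurable_limit_slice τ, ?_, ?_, hPh.sum_mul_limit hdd τ, hPh.limit_conj_symm hdc τ⟩
      · -- the a priori bound through the global energy of `G_n`
        rw [← hGend]
        calc eLpNorm (gGlue c m K a n (((n : ℝ) + 1) * τ)) 2 volume
            ≤ (Fintype.card ι : ℝ≥0∞) * eLpNorm (gGlue c m K a n 0) 2 volume :=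
              hG.eLpNorm_le_card_mul h.one_le_K ⟨by positivity, le_rfl⟩
          _ = gRadius a := by rw [hG0, gRadius]
      · exact (hPh.eLpNorm_wfun_limit_le τ).trans_lt (ENNReal.mul_lt_top ENNReal.ofNat_lt_top hdK)
    refine ⟨hd', ?_⟩
    have hPh' := hP hd'.1 hd'.2.1 hd'.2.2.1
    have hM' : IsRegMild c m K 0 τ (gPiece c m K a (n + 1)) := hPh'.isRegMild_limit h.hK hd'.2.2.2.1 hd'.2.2.2.2
    -- translate the new piece to `[(n+1)τ, (n+2)τ]` and glue
    have hW : IsRegMild c m K (((n : ℝ) + 1) * τ) (τ + ((n : ℝ) + 1) * τ)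
        (fun t => gPiece c m K a (n + 1) (t - ((n : ℝ) + 1) * τ)) := by
      have := hM'.translate (((n : ℝ) + 1) * τ)
      rwa [zero_add] at this
    have hjoin : gGlue c m K a n (((n : ℝ) + 1) * τ) = (fun t => gPiece c m K a (n + 1) (t - ((n : ℝ) + 1) * τ)) (((n : ℝ) + 1) * τ) := by
      rw [hGend]
      simp only [sub_self, gPiece]
      funext ξ; exact (hPh'.limit_zero ξ).symm
    have hglue := hG.glue hW hjoin
    refine ⟨?_, ?_, ?_⟩
    · have e : τ + ((n : ℝ) + 1) * τ = (((n + 1 : ℕ) : ℝ) + 1) * τ := by push_cast; ring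
      rw [e] at hglue
      exact hglue
    · show (if (((n + 1 : ℕ) : ℝ) + 1) * τ ≤ ((n : ℝ) + 1) * τ then gGlue c m K a n ((((n + 1 : ℕ) : ℝ) + 1) * τ)
        else gPiece c m K a (n + 1) ((((n + 1 : ℕ) : ℝ) + 1) * τ - ((n : ℝ) + 1) * τ)) = gData c m K a (n + 1 + 1)
      rw [if_neg (by push_cast; nlinarith)]
      simp only [gData, gPiece]
      congr 1; push_cast; ring
    · show (if (0 : ℝ) ≤ ((n : ℝ) + 1) * τ then gGlue c m K a n 0 else gPiece c m K a (n + 1) (0 - ((n : ℝ) + 1) * τ)) = a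
      rw [if_pos (by positivity), hG0]

/-- **Stability of the glued fields**: `G_M(t) = G_n(t)` for `n ≤ M` and `t ≤ (n+1)τ`. [folklore] -/
theorem gGlue_stable (h : GlobalHyp c m K a) {n M : ℕ} (hnM : n ≤ M) {t : ℝ}
    (ht : t ≤ ((n : ℝ) + 1) * gStep c m K a) : gGlue c m K a M t = gGlue c m K a n t := by
  induction M, hnM using Nat.le_induction with
  | base => rfl
  | succ M hnM ih =>
    have hnM' : (n : ℝ) ≤ M := by exact_mod_cast hnM
    have hle : t ≤ ((M : ℝ) + 1) * gStep c m K a :=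
      ht.trans (mul_le_mul_of_nonneg_right (by linarith) h.gStep_pos.le)
    show (if t ≤ ((M : ℝ) + 1) * gStep c m K a then gGlue c m K a M t
      else gPiece c m K a (M + 1) (t - ((M : ℝ) + 1) * gStep c m K a)) = gGlue c m K a n t
    rw [if_pos hle, ih]

/-- `G₀(t) = a` for `t ≤ 0` (the Picard limit is frozen at the datum before time `0`). [folklore] -/
theorem gGlue_zero_of_nonpos (h : GlobalHyp c m K a) {t : ℝ} (ht : t ≤ 0) : gGlue c m K a 0 t = a := by
  have hPh : RPicardHyp c m K (gStep c m K a) (gRadius a) (eLpNorm (wfun K a) 2 volume) a :=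
    RPicardHyp.of_rpicardTime h.hc h.hm h.meas h.eLpNorm_le_gRadius le_rfl h.gRadius_ne_top h.memL2K.ne
  show gPiece c m K a 0 t = a
  funext ξ
  rw [gPiece, gData, ← hPh.limit_clamp t ξ, show clamp (gStep c m K a) t = 0 from by
    rw [clamp, min_eq_left (ht.trans h.gStep_pos.le), max_eq_left ht], hPh.limit_zero]

/-- **The global solution before time `0` is the datum**: `V(t) = a` for `t ≤ 0`; in particular
`V(0) = a`. [folklore] -/
theorem gSol_of_nonpos (h : GlobalHyp c m K a) {t : ℝ} (ht : t ≤ 0) : gSol c m K a t = a := by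
  rw [gSol, Nat.ceil_eq_zero.2 (div_nonpos_of_nonpos_of_nonneg ht h.gStep_pos.le)]
  exact h.gGlue_zero_of_nonpos ht

/-- `V(0) = a`. [folklore] -/
theorem gSol_zero (h : GlobalHyp c m K a) : gSol c m K a 0 = a := h.gSol_of_nonpos le_rfl

/-- **The global solution is a regularised mild solution on every `[0, T]`** (frozen after `T`):
`t ↦ V(min t T)` agrees with the glued field `G_M`, `M = ⌈T/τ⌉`, frozen after `T`
(Leray 1934, §26: "la solution … est définie pour toutes les valeurs de t"; Ożański–Pooley 2018,
Thm. 6.33). [folklore] -/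
theorem isRegMild_gSol (h : GlobalHyp c m K a) {T : ℝ} (hT : 0 < T) :
    IsRegMild c m K 0 T (fun t => gSol c m K a (min t T)) := by
  set τ := gStep c m K a with hτdef
  have hτ : 0 < τ := h.gStep_pos
  set M : ℕ := ⌈T / τ⌉₊ with hMdef
  have hTM : T ≤ ((M : ℝ) + 1) * τ := by
    have h1 : T / τ ≤ M := Nat.le_ceil _
    rw [div_le_iff₀ hτ] at h1
    nlinarith
  -- `V(min t T) = G_M(min t T)`
  have hfun : (fun t => gSol c m K a (min t T)) = fun t => gGlue c m K a M (min t T) := by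
    funext t
    rw [gSol]
    have hn : ⌈min t T / τ⌉₊ ≤ M := Nat.ceil_mono (div_le_div_of_nonneg_right (min_le_right t T) hτ.le)
    refine (h.gGlue_stable hn ?_).symm
    -- `min t T ≤ (⌈min t T / τ⌉ + 1) τ`
    rcases le_total (min t T) 0 with h0 | h0
    · exact h0.trans (by positivity)
    · have h1 : min t T / τ ≤ ⌈min t T / τ⌉₊ := Nat.le_ceil _
      rw [div_le_iff₀ hτ] at h1
      nlinarith
  rw [hfun]
  exact (h.step M).2.1.clampRight hT.le hTM

end GlobalHyp

/-- **Global existence of regularised mild solutions** (Leray 1934, Ch. V §26: the regularised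
Navier–Stokes system has a solution "définie pour toutes les valeurs de t", the existence time of
the successive approximations depending on `W(0)` only and `W(t)` being non-increasing;
Ożański–Pooley 2018, Thm. 6.33; Lemarié-Rieusset 2016, Thm. 7.2): for `c > 0`, a mollifier symbol
`m`, a weight `K` with `2K > card ι` and a measurable, square-integrable, `wfun K`-square-integrable,
transversal, conjugation-symmetric Fourier datum `a`, there is `V : ℝ → E → (ι → ℂ)` with `V t = a`
for `t ≤ 0` such that `t ↦ V(min t T)` is a regularised mild solution on `[0, T]` for every `T > 0`. [folklore] -/
theorem exists_global_regMild (h : GlobalHyp c m K a) :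
    ∃ V : ℝ → (EuclideanSpace ℝ ι) → ι → ℂ, (∀ t ≤ 0, V t = a) ∧
      ∀ T, 0 < T → IsRegMild c m K 0 T (fun t => V (min t T)) :=
  ⟨gSol c m K a, fun _ ht => h.gSol_of_nonpos ht, fun _ hT => h.isRegMild_gSol hT⟩

/-- **The global solution has every admissible weight of its datum**: if moreover
`wfun K' a ∈ L²` with `2K' > card ι`, then `t ↦ V(min t T)` (built with weight `K`) is also a
regularised mild solution of weight `K'` on `[0, T]` — it coincides with the weight-`K'`
construction by uniqueness. [folklore] -/
theorem GlobalHyp.isRegMild_gSol_weight (h : GlobalHyp c m K a) {K' : ℕ} (hK' : Fintype.card ι < 2 * K')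
    (haK' : eLpNorm (wfun K' a) 2 volume < ∞) {T : ℝ} (hT : 0 < T) :
    IsRegMild c m K' 0 T (fun t => gSol c m K a (min t T)) := by
  have h' : GlobalHyp c m K' a := ⟨h.hc, h.hm, hK', h.meas, h.memL2, haK', h.divFree, h.conjSymm⟩
  have hS := h.isRegMild_gSol hT
  have hS' := h'.isRegMild_gSol hT
  have heq : ∀ t ∈ Icc 0 T, gSol c m K a (min t T) = gSol c m K' a (min t T) :=
    IsRegMild.unique hS hS' (by
      show gSol c m K a (min 0 T) = gSol c m K' a (min 0 T)
      rw [min_eq_left hT.le, h.gSol_zero, h'.gSol_zero])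
  have hfun : (fun t => gSol c m K a (min t T)) = fun t => gSol c m K' a (min t T) := by
    funext t
    rcases le_total t 0 with ht | ht
    · rw [min_eq_left (ht.trans hT.le), h.gSol_of_nonpos ht, h'.gSol_of_nonpos ht]
    · have := heq (min t T) ⟨le_min ht hT.le, min_le_right _ _⟩
      simpa only [min_assoc, min_self] using this
  rw [hfun]
  exact hS'

end Global

end Literature.Analysis.FluidPDE.FourierNS

end
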